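import Mathlib
import Summits.ValiantsHypothesis.ValiantsHypothesis.Theorems.PolyaContinuedLaplaceRigiditySingCodimEight
import HarnessLib

/-!
# Torus stability of the top-dimensional components of `Sing(per₄)`: minimal primes over the
# sub-permanent ideals are MULTIHOMOGENEOUS for every row/column-additive weight

Helper file for crux `CoverDecancellation` (stmt-ValiantsHypothesis-17819), line `component_rigidity`
(val-idea-10 g3), stub B-row `RowPrimeRigidity` — the GRADING half (B-i) of val-width-17819-w1 g2's K-core
split (val-width STATUS 2026-08-28 10:30Z; val-lit-p11 g2 pointer (3)); porter/prover val-port-4 g1.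
NO definitions; everything BY NAME over the tree's `subpermIdeal` / `rsubperm` (BCMV 2025 file) and
`VonZurGathen.singPermIdeal`.

* `weightedHomogeneousComponent_mem_of_mem_minimalPrimes_span` — **minimal primes over an ideal of `R[X_σ]`
  spanned by weighted-homogeneous polynomials contain, with an element, all its weighted-homogeneous
  components**, for any weight `w : σ → M` into a linearly ordered cancellative additive monoid (inside the
  proof: Mathlib's weighted grading `MvPolynomial.weightedGradedAlgebra`, `Ideal.homogeneous_span`, the
  homogeneous core of a prime is prime `Ideal.IsPrime.homogeneousCore`, and
  `MvPolynomial.mem_iff_weightedHomogeneousComponent_mem`; the STATEMENT is grading-free).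
* `isWeightedHomogeneous_rsubperm_X` — every sub-permanent `per[Rw | Cl](X)` of the generic `k × n` matrix is
  weighted-homogeneous, of weight `Σ_{r ∈ Rw} a r + Σ_{c ∈ Cl} b c`, for EVERY row/column-additive weight
  `w (r, c) = a r + b c` (values in any additive commutative monoid): the torus `(𝔾_m)^k × (𝔾_m)^n` acts.
* `weightedHomogeneousComponent_mem_of_mem_minimalPrimes_subpermIdeal` — hence minimal primes over BCMV's
  ideal `subpermIdeal F k n h` of the `h × h` sub-permanents are closed under weighted components for all
  such weights.
* ★ `weightedHomogeneousComponent_mem_of_subpermIdeal_four_le` /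
  `weightedHomogeneousComponent_mem_of_singPermIdeal_four_le` — **the top primes of `Sing(per₄)` are
  torus-stable**: a prime `P ⊇ singPermIdeal F 4` (`= subpermIdeal F 4 4 3`) of height `≤ 8` is a MINIMAL
  prime (`SingCodim.height_singPermIdeal_four`, Mathlib `Ideal.mem_minimalPrimes_of_height_eq`), so for every
  row/column-additive weight into a linearly ordered cancellative monoid and every `f ∈ P`, each weighted
  component of `f` lies in `P` (`2 ≠ 0`, `3 ≠ 0` in `F`).  Consumers instantiate `M := Lex (Fin 8 → ℕ)` with
  `a i := toLex (Pi.single (Fin.castAdd 4 i) 1)`, `b j := toLex (Pi.single (Fin.natAdd 4 j) 1)` (the full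
  `ℕ⁴ × ℕ⁴` grading), or `M := ℕ` with the indicator weight of one row / one column.

HONEST FRAMING: elementary graded commutative algebra [folklore]; it is an INPUT of stub B-row (the
monomial/binomial case analysis B-ii over 17819-w1 g2's generic-point lemmas T7/T8 is NOT in this file).
Crux 17819 `CoverDecancellation` stays HELD; no rung of the strength ladder moves; nothing here bears on
`VP ≠ VNP`, which is NOT proved.
-/

set_option autoImplicit false

-- the mandated summit-side namespace repeats a component by design (single-problem summit)
set_option linter.dupNamespace false

noncomputable section

open MvPolynomial

namespace Summit.ValiantsHypothesis.ValiantsHypothesis.Theorems.PolyaContinuedLaplaceRigidity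

namespace SingGrading

open Literature.Computability.AlgebraicComplexity
open Literature.Computability.AlgebraicComplexity.BoraleviCarliniMichalekVentura2025

/-! ## Minimal primes over weighted-homogeneous ideals -/

/-- **Minimal primes over an ideal spanned by weighted-homogeneous polynomials contain the
weighted-homogeneous components of their elements.**  For a weight `w : σ → M` into a linearly ordered
cancellative additive monoid, a set `s` of `w`-homogeneous polynomials and a minimal prime `P` of
`Ideal.span s`: for the weighted grading, `Ideal.span s` is homogeneous and the homogeneous core of `P` is a
prime between `Ideal.span s` and `P`, hence equals `P`; so `P` is homogeneous, i.e. closed under taking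
weighted components.  (The grading structure is used only inside the proof.) [folklore] -/
theorem weightedHomogeneousComponent_mem_of_mem_minimalPrimes_span {σ R M : Type*} [CommRing R]
    [AddCommMonoid M] [LinearOrder M] [IsOrderedCancelAddMonoid M] (w : σ → M)
    {s : Set (MvPolynomial σ R)} (hs : ∀ x ∈ s, ∃ m, IsWeightedHomogeneous w x m)
    {P : Ideal (MvPolynomial σ R)} (hP : P ∈ (Ideal.span s).minimalPrimes)
    {f : MvPolynomial σ R} (hf : f ∈ P) (m : M) :
    weightedHomogeneousComponent w m f ∈ P := by
  letI := MvPolynomial.weightedGradedAlgebra R w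
  have hI : (Ideal.span s).IsHomogeneous (weightedHomogeneousSubmodule R w) := by
    refine Ideal.homogeneous_span _ _ fun x hx => ?_
    obtain ⟨m, hm⟩ := hs x hx
    exact ⟨m, (mem_weightedHomogeneousSubmodule R w m x).mpr hm⟩
  have hPprime : P.IsPrime := hP.1.1
  have hQprime : (P.homogeneousCore (weightedHomogeneousSubmodule R w)).toIdeal.IsPrime :=
    hPprime.homogeneousCore
  have hIQ : Ideal.span s ≤ (P.homogeneousCore (weightedHomogeneousSubmodule R w)).toIdeal := by
    rw [← hI.toIdeal_homogeneousCore_eq_self]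
    exact Ideal.homogeneousCore_mono _ hP.1.2
  have hQP : (P.homogeneousCore (weightedHomogeneousSubmodule R w)).toIdeal ≤ P :=
    Ideal.toIdeal_homogeneousCore_le _ P
  have hPQ : P ≤ (P.homogeneousCore (weightedHomogeneousSubmodule R w)).toIdeal :=
    hP.2 ⟨hQprime, hIQ⟩ hQP
  have hPhom : P.IsHomogeneous (weightedHomogeneousSubmodule R w) := by
    rw [← le_antisymm hQP hPQ]
    exact (P.homogeneousCore _).isHomogeneous
  exact ((mem_iff_weightedHomogeneousComponent_mem R w hPhom f).mp hf m :)

/-! ## Sub-permanents are multihomogeneous for the row/column torus -/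

/-- **Every sub-permanent of the generic matrix is weighted-homogeneous for every row/column-additive
weight.**  For `w (r, c) = a r + b c` the sub-permanent `per[Rw | Cl](X) = Σ_f ∏_{c ∈ Cl} X_{f(c), c}`
(`f` over the bijections `Cl ≃ Rw`) has all its monomials of weight `Σ_{r ∈ Rw} a r + Σ_{c ∈ Cl} b c`.
[folklore] -/
theorem isWeightedHomogeneous_rsubperm_X {F : Type*} [CommRing F] {M : Type*} [AddCommMonoid M]
    {k n : ℕ} (a : Fin k → M) (b : Fin n → M) (Rw : Finset (Fin k)) (Cl : Finset (Fin n)) :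
    IsWeightedHomogeneous (fun e : Fin k × Fin n => a e.1 + b e.2)
      (rsubperm (Matrix.mvPolynomialX (Fin k) (Fin n) F) (· ∈ Cl) (· ∈ Rw))
      (∑ r : {r // r ∈ Rw}, a r + ∑ c : {c // c ∈ Cl}, b c) := by
  classical
  unfold rsubperm
  refine IsWeightedHomogeneous.sum _ _ _ fun f _ => ?_
  have h := IsWeightedHomogeneous.prod (w := fun e : Fin k × Fin n => a e.1 + b e.2) Finset.univ
    (fun c : {c // c ∈ Cl} => Matrix.mvPolynomialX (Fin k) (Fin n) F (f c) c)
    (fun c => a (f c) + b c) (fun c _ => by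
      rw [Matrix.mvPolynomialX_apply]
      exact isWeightedHomogeneous_X F (fun e : Fin k × Fin n => a e.1 + b e.2) _)
  have hsum : ∑ c : {c // c ∈ Cl}, (a (f c) + b c) =
      ∑ r : {r // r ∈ Rw}, a r + ∑ c : {c // c ∈ Cl}, b c := by
    rw [Finset.sum_add_distrib, Equiv.sum_comp f (fun r : {r // r ∈ Rw} => a r)]
  rw [hsum] at h
  -- the two `Fintype` structures on the subtype `{c // c ∈ Cl}` agree (a subsingleton)
  convert h

/-- **Minimal primes over BCMV's sub-permanent ideal `subpermIdeal F k n h` are closed under weighted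
components, for every row/column-additive weight** into a linearly ordered cancellative monoid (the generators
are weighted-homogeneous, `isWeightedHomogeneous_rsubperm_X`). [folklore] -/
theorem weightedHomogeneousComponent_mem_of_mem_minimalPrimes_subpermIdeal {F : Type*} [CommRing F]
    {M : Type*} [AddCommMonoid M] [LinearOrder M] [IsOrderedCancelAddMonoid M] {k n h : ℕ}
    (a : Fin k → M) (b : Fin n → M) {P : Ideal (MvPolynomial (Fin k × Fin n) F)}
    (hP : P ∈ (subpermIdeal F k n h).minimalPrimes) {f : MvPolynomial (Fin k × Fin n) F} (hf : f ∈ P)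
    (m : M) : weightedHomogeneousComponent (fun e : Fin k × Fin n => a e.1 + b e.2) m f ∈ P := by
  unfold subpermIdeal at hP
  refine weightedHomogeneousComponent_mem_of_mem_minimalPrimes_span _ (fun x hx => ?_) hP hf m
  obtain ⟨Rw, Cl, -, -, rfl⟩ := hx
  exact ⟨_, isWeightedHomogeneous_rsubperm_X a b Rw Cl⟩

/-! ## The top primes of `Sing(per₄)` are torus-stable -/

/-- A prime of height `≤ 8` over the `3 × 3` sub-permanents of the generic `4 × 4` matrix is a MINIMAL prime
of that ideal (`2 ≠ 0`, `3 ≠ 0`): the ideal has height `8` (`SingCodim.height_singPermIdeal_four` with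
`singPermIdeal_eq_subpermIdeal`). [cite: AlperBogartVelasco2017, §1 and Rem. 1.5] -/
theorem mem_minimalPrimes_subpermIdeal_four {F : Type*} [Field F] (h2 : (2 : F) ≠ 0) (h3 : (3 : F) ≠ 0)
    (P : Ideal (MvPolynomial (Fin 4 × Fin 4) F)) [P.IsPrime] (hle : subpermIdeal F 4 4 3 ≤ P)
    (h8 : P.height ≤ 8) : P ∈ (subpermIdeal F 4 4 3).minimalPrimes := by
  haveI : P.FiniteHeight := ⟨Or.inr (ne_top_of_le_ne_top (ENat.coe_ne_top 8) h8)⟩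
  refine Ideal.mem_minimalPrimes_of_height_eq hle ?_
  rw [← singPermIdeal_eq_subpermIdeal F (m := 4) (by norm_num), SingCodim.height_singPermIdeal_four F h2 h3]
  exact h8

/-- ★ **Torus stability of the top primes over the sub-permanents**: for a prime `P ⊇ subpermIdeal F 4 4 3`
of height `≤ 8`, every row/column-additive weight `w (r, c) = a r + b c` into a linearly ordered cancellative
monoid, every `f ∈ P` and every weight `m`, the `w`-component of `f` of weight `m` lies in `P`
(`2 ≠ 0`, `3 ≠ 0`). [folklore] -/
theorem weightedHomogeneousComponent_mem_of_subpermIdeal_four_le {F : Type*} [Field F]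
    (h2 : (2 : F) ≠ 0) (h3 : (3 : F) ≠ 0) {M : Type*} [AddCommMonoid M] [LinearOrder M]
    [IsOrderedCancelAddMonoid M] (a b : Fin 4 → M) (P : Ideal (MvPolynomial (Fin 4 × Fin 4) F))
    [P.IsPrime] (hle : subpermIdeal F 4 4 3 ≤ P) (h8 : P.height ≤ 8)
    {f : MvPolynomial (Fin 4 × Fin 4) F} (hf : f ∈ P) (m : M) :
    weightedHomogeneousComponent (fun e : Fin 4 × Fin 4 => a e.1 + b e.2) m f ∈ P :=
  weightedHomogeneousComponent_mem_of_mem_minimalPrimes_subpermIdeal a b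
    (mem_minimalPrimes_subpermIdeal_four h2 h3 P hle h8) hf m

/-- ★ **Torus stability of the top primes of `Sing(per₄)`** (the form stub B-row consumes): for a prime
`P ⊇ singPermIdeal F 4 = (per₄, ∂per₄)` of height `≤ 8`, every row/column-additive weight into a linearly
ordered cancellative monoid, every `f ∈ P` and every weight `m`, the weighted component of `f` of weight `m`
lies in `P` (`2 ≠ 0`, `3 ≠ 0`). [folklore] -/
theorem weightedHomogeneousComponent_mem_of_singPermIdeal_four_le {F : Type*} [Field F]
    (h2 : (2 : F) ≠ 0) (h3 : (3 : F) ≠ 0) {M : Type*} [AddCommMonoid M] [LinearOrder M]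
    [IsOrderedCancelAddMonoid M] (a b : Fin 4 → M) (P : Ideal (MvPolynomial (Fin 4 × Fin 4) F))
    [P.IsPrime] (hle : VonZurGathen.singPermIdeal F 4 ≤ P) (h8 : P.height ≤ 8)
    {f : MvPolynomial (Fin 4 × Fin 4) F} (hf : f ∈ P) (m : M) :
    weightedHomogeneousComponent (fun e : Fin 4 × Fin 4 => a e.1 + b e.2) m f ∈ P := by
  rw [singPermIdeal_eq_subpermIdeal F (m := 4) (by norm_num)] at hle
  exact weightedHomogeneousComponent_mem_of_subpermIdeal_four_le h2 h3 a b P hle h8 hf m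

/-- The complex case, hypotheses as in `RowPrimeRigidity` (`P` prime, `singPermIdeal ℂ 4 ≤ P`,
`P.height ≤ 8`). [folklore] -/
theorem weightedHomogeneousComponent_mem_of_singPermIdeal_four_le_complex {M : Type*} [AddCommMonoid M]
    [LinearOrder M] [IsOrderedCancelAddMonoid M] (a b : Fin 4 → M)
    (P : Ideal (MvPolynomial (Fin 4 × Fin 4) ℂ)) [P.IsPrime] (hle : VonZurGathen.singPermIdeal ℂ 4 ≤ P)
    (h8 : P.height ≤ 8) {f : MvPolynomial (Fin 4 × Fin 4) ℂ} (hf : f ∈ P) (m : M) :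
    weightedHomogeneousComponent (fun e : Fin 4 × Fin 4 => a e.1 + b e.2) m f ∈ P :=
  weightedHomogeneousComponent_mem_of_singPermIdeal_four_le (by norm_num) (by norm_num) a b P hle h8 hf m

end SingGrading

end Summit.ValiantsHypothesis.ValiantsHypothesis.Theorems.PolyaContinuedLaplaceRigidity

end
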